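import Summits.CriticalPhenomena.CardyFormulaZ2.Theorems.CardyComplexConeEdgePrecompactUFRSTwoArcSurround
import Summits.CriticalPhenomena.CardyFormulaZ2.Theorems.CardyComplexConeEdgePrecompactUFRSStrands

set_option linter.unusedVariables false

/-!
# Slipped return, BALL-EXIT pair: the far-reaching excursion polygon
(line `qkz-strip-boundary-arm` of crux `CardyComplexCone.EdgePrecompact`, stmt-CriticalPhenomena-11387;
first step of the residual `ufrs_slippedReturnCase_cert(J)` in its ball-exit sub-case)

The residual "slipped return" of the SPLIT branch of the UFRS arm domination
(`…UFRSArmDominationResiduals.lean`): the first stretch `S₀ = O₀ a [0, n]` of the dynamics of `E`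
leaves the `2ρ`-deep ball `B(E.δ v, ρ)` at `a` and re-enters it at time `n`; the translate's dynamics
from the same corner, `G₁ = O₁ a [0, k]`, is synchronised with `S₀` up to the split corner
`e = O₀ a m = O₁ a k`, and the run `O₁ e [0, T]` ends AT the re-entry corner `O₀ a n` with a turning
mismatch. `ufrs_slippedReturn_ballExit_surround_SR`: in the BALL-EXIT pair (`a = a'`, `cSrc a` in the
ball) the hypotheses of the planar input `medialTwoArcSurround_ball` hold for the two stretches `S₀`
and `G₁ · run = O₁ a [0, k + T]` (both simple by `cornerOrbit_injOn_stretch`, same last corner,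
turning sums different by synchronisation + mismatch, all intermediate target midpoints off the
ball), whence an excursion of the second stretch relative to `S₀` whose polygon is far-reaching with
respect to the exit point `medialPoint E.δ (cSrc a)`. The hypotheses are those of the J-form residual
verbatim (several are not used here), with the pair hypothesis specialised.

References: S. Smirnov, C. R. Acad. Sci. Paris 333 (2001), §2; H. Hopf, Compositio Math. 2 (1935).
-/

namespace Summit.CriticalPhenomena.CardyFormulaZ2.Cruxes.EdgePrecompact.QkzStripBoundaryArm

open MeasureTheory Filter Set Metric
open scoped Topology BigOperators Pointwise
open Literature.Probability.LatticeModels Literature.Probability.Percolation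
open Literature.Probability.RandomPlanarGeometry (DobrushinDomain)
open Summit.CriticalPhenomena.CardyFormulaZ2.Theses.CardyComplexCone

noncomputable section

/-- **Slipped return, ball-exit pair: a far-reaching excursion polygon** (registered helper). DATA:
the hypotheses of `ufrs_slippedReturnCase_certJ` with the pair hypothesis specialised to `a = a'`
and `medialPoint E.δ (cSrc a) ∈ B(E.δ v, ρ)`. CONCLUSION: an excursion `(s, t, σ, τ)` of
`O₁ a' [0, k + T]` relative to `S₀ = O₀ a [0, n]` (consecutive common corners `O₁ a' s = O₀ a σ`,
`O₁ a' t = O₀ a τ`, `s < t ≤ k + T`, `σ < n`, `1 ≤ τ ≤ n`, free in between, not a common step) whose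
polygon (target midpoints of `O₁ a' j`, `j ∈ [s, t)`, and of `O₀ a i`, `i ∈ [σ, τ)` resp. `[τ-1, σ]`)
is far-reaching with respect to `medialPoint E.δ (cSrc a)`. -/
theorem ufrs_slippedReturn_ballExit_surround_SR : ∀ (D : DobrushinDomain) (η : ℝ), 0 < η → ∃ δ₀ > (0:ℝ), ∀ E : DiscreteDobrushin, E.Ω = D.carrier → E.IsZdAdmissible → E.δ < δ₀ → ∀ (v w : Site 2) (ρ : ℝ), 4 * η ≤ ρ → 2 * ρ ≤ infDist (meshPoint E.δ v) D.carrierᶜ → ‖meshPoint E.δ w‖ < η → ∀ (ω : BondConfig (Site 2)) (a a' : Site 2 × Fin 4) (n m k T : ℕ), a = a' → medialPoint E.δ (cSrc a) ∈ ball (meshPoint E.δ v) ρ → (∀ i < n, medialPoint E.δ (cTgt (cornerOrbit (E.bcBondConfig ω) a i)) ∉ ball (meshPoint E.δ v) ρ ∧ E.IsInnerFace (cFace (cornerOrbit (E.bcBondConfig ω) a (i + 1)))) → medialPoint E.δ (cTgt (cornerOrbit (E.bcBondConfig ω) a n)) ∈ ball (meshPoint E.δ v) ρ → m < n → (∀ i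 < k, medialPoint E.δ (cTgt (cornerOrbit ((shiftData E w).bcBondConfig ω) a' i)) ∉ ball (meshPoint E.δ v) ρ ∧ (shiftData E w).IsInnerFace (cFace (cornerOrbit ((shiftData E w).bcBondConfig ω) a' (i + 1)))) → cornerOrbit ((shiftData E w).bcBondConfig ω) a' k = cornerOrbit (E.bcBondConfig ω) a m → ∑ i ∈ Finset.range k, turnOf ((shiftData E w).bcBondConfig ω) (cornerOrbit ((shiftData E w).bcBondConfig ω) a' i) = ∑ i ∈ Finset.range m, turnOf (E.bcBondConfig ω) (cornerOrbit (E.bcBondConfig ω) a i) → infDist (meshPoint E.δ (cornerOrbit (E.bcBondConfig ω) a m).1) D.carrierᶜ < 3 * η → ¬ (cTgt (cornerOrbit (E.bcBondConfig ω) a m) ∈ E.bcBondConfig ω ↔ cTgt (cornerOrbit (E.bcBondConfig ω) a m) ∈ (shiftData E w).bcBondConfig ω) → (∀ j j₀ : ℕ, m < j₀ → j₀ ≤ n → (∀ i < j, medialPoint E.δ (cTgt (cornerOrbit ((shiftData E w).bcBondConfig ω) (cornerOrbit (E.bcBondConfig ω) a m) i)) ∉ ball (meshPoint E.δ v) ρ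 ∧ (shiftData E w).IsInnerFace (cFace (cornerOrbit ((shiftData E w).bcBondConfig ω) (cornerOrbit (E.bcBondConfig ω) a m) (i + 1)))) → cornerOrbit ((shiftData E w).bcBondConfig ω) (cornerOrbit (E.bcBondConfig ω) a m) j = cornerOrbit (E.bcBondConfig ω) a j₀ → ∑ i ∈ Finset.range j, turnOf ((shiftData E w).bcBondConfig ω) (cornerOrbit ((shiftData E w).bcBondConfig ω) (cornerOrbit (E.bcBondConfig ω) a m) i) ≠ ∑ i ∈ Finset.Ico m j₀, turnOf (E.bcBondConfig ω) (cornerOrbit (E.bcBondConfig ω) a i)) → (∀ i < T, medialPoint E.δ (cTgt (cornerOrbit ((shiftData E w).bcBondConfig ω) (cornerOrbit (E.bcBondConfig ω) a m) i)) ∉ ball (meshPoint E.δ v) ρ ∧ (shiftData E w).IsInnerFace (cFace (cornerOrbit ((shiftData E w).bcBondConfig ω) (cornerOrbit (E.bcBondConfig ω) a m) (i + 1)))) → (medialPoint E.δ (cTgt (cornerOrbit ((shiftData E w).bcBondConfig ω) (cornerOrbit (E.bcBondConfig ω) a m) T)) ∈ ball (meshPoint E.δ v) ρ ∨ ¬ (shiftData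 E w).IsInnerFace (cFace (cornerOrbit ((shiftData E w).bcBondConfig ω) (cornerOrbit (E.bcBondConfig ω) a m) (T + 1)))) → cornerOrbit ((shiftData E w).bcBondConfig ω) (cornerOrbit (E.bcBondConfig ω) a m) T = cornerOrbit (E.bcBondConfig ω) a n → medialPoint E.δ (cTgt (cornerOrbit ((shiftData E w).bcBondConfig ω) (cornerOrbit (E.bcBondConfig ω) a m) T)) ∈ ball (meshPoint E.δ v) ρ → ∃ s t σ τ : ℕ, s < t ∧ t ≤ k + T ∧ σ < n ∧ 1 ≤ τ ∧ τ ≤ n ∧ cornerOrbit ((shiftData E w).bcBondConfig ω) a' s = cornerOrbit (E.bcBondConfig ω) a σ ∧ cornerOrbit ((shiftData E w).bcBondConfig ω) a' t = cornerOrbit (E.bcBondConfig ω) a τ ∧ (∀ j, s < j → j < t → ∀ i ≤ n, cornerOrbit ((shiftData E w).bcBondConfig ω) a' j ≠ cornerOrbit (E.bcBondConfig ω) a i) ∧ ¬ (t = s + 1 ∧ τ = σ + 1) ∧ (∀ q₀ : ℂ, ∃ q ∈ ((fun j => medialPoint E.δ (cTgt (cornerOrbit ((shiftData E w).bcBondConfig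 ω) a' j))) '' Set.Ico s t ∪ (fun i => medialPoint E.δ (cTgt (cornerOrbit (E.bcBondConfig ω) a i))) '' (if σ < τ then Set.Ico σ τ else Set.Ico (τ - 1) (σ + 1))), dist (medialPoint E.δ (cSrc a)) q₀ ≤ dist q q₀ + E.δ) := by
  intro D η hη
  refine ⟨1, one_pos, ?_⟩
  intro E hEΩ hE hEδ v w ρ hηρ hv hw ω a a' n m k T haa hA hStr hball hmn hG hek hsum hcol hdisc hmis hrun hTend
    hret hTball
  subst haa
  set β₀ := E.bcBondConfig ω with hβ₀
  set β₁ := (shiftData E w).bcBondConfig ω with hβ₁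
  have hδ : 0 < E.δ := hE.delta_pos
  -- the second stretch `O₁ a [0, k + T]`
  have hO₁ : ∀ i, cornerOrbit β₁ a (k + i) = cornerOrbit β₁ (cornerOrbit β₀ a m) i := fun i => by
    rw [cornerOrbit_add_eq, hek]
  have hend : cornerOrbit β₀ a n = cornerOrbit β₁ a (k + T) := by rw [hO₁, hret]
  have hinj₀ : ∀ i j : ℕ, i ≤ n → j ≤ n → cornerOrbit β₀ a i = cornerOrbit β₀ a j → i = j :=
    fun i j hi hj h => cornerOrbit_injOn_stretch (I := {e | medialPoint E.δ e ∈ ball (meshPoint E.δ v) ρ})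
      (fun i hi => (hStr i hi).1) hball hi hj h
  have hout₁ : ∀ j < k + T, medialPoint E.δ (cTgt (cornerOrbit β₁ a j)) ∉ ball (meshPoint E.δ v) ρ := by
    intro j hj
    rcases Nat.lt_or_ge j k with hjk | hjk
    · exact (hG j hjk).1
    · obtain ⟨i, rfl⟩ := Nat.exists_eq_add_of_le hjk
      rw [hO₁]
      exact (hrun i (by omega)).1
  have hin₁ : medialPoint E.δ (cTgt (cornerOrbit β₁ a (k + T))) ∈ ball (meshPoint E.δ v) ρ := by
    rw [hO₁]; exact hTball
  have hinj₁ : ∀ i j : ℕ, i ≤ k + T → j ≤ k + T → cornerOrbit β₁ a i = cornerOrbit β₁ a j → i = j :=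
    fun i j hi hj h => cornerOrbit_injOn_stretch (I := {e | medialPoint E.δ e ∈ ball (meshPoint E.δ v) ρ})
      hout₁ hin₁ hi hj h
  -- the turning sums differ: synchronisation up to the split, mismatch along the run
  have hturn : ∑ i ∈ Finset.range n, turnOf β₀ (cornerOrbit β₀ a i) ≠
      ∑ j ∈ Finset.range (k + T), turnOf β₁ (cornerOrbit β₁ a j) := by
    intro h
    rw [Finset.sum_range_add] at h
    simp only [hO₁] at h
    rw [hsum, ← Finset.sum_range_add_sum_Ico _ hmn.le] at h
    exact hmis T n hmn le_rfl hrun hret (by linarith)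
  obtain ⟨s, t, σ, τ, hst, htn, hσn, hτ1, hτn, hs, ht, hfree, hntriv, hfar⟩ :=
    medialTwoArcSurround_ballA_SR β₀ β₁ a n (k + T) E.δ v ρ hδ hinj₀ hinj₁ hend hturn hA (fun i hi => (hStr i hi).1)
      hout₁ (hend ▸ hball)
  exact ⟨s, t, σ, τ, hst, htn, hσn, hτ1, hτn, hs, ht, hfree, hntriv, hfar⟩

end

end Summit.CriticalPhenomena.CardyFormulaZ2.Cruxes.EdgePrecompact.QkzStripBoundaryArm
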